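import Summits.KontsevichZagierPeriods.KontsevichZagierPeriods.Theorems.GrothendieckSectorComplementRingJoin
import Summits.KontsevichZagierPeriods.KontsevichZagierPeriods.Theorems.UnfoldedStokesStokesGenerationLineReductionNamed
import Summits.KontsevichZagierPeriods.KontsevichZagierPeriods.Cruxes.SectorComplement.Strategist

/-!
# Stub-ideation k=1 (FAMILY 1 — RECOGNISE & IMPORT) for `stub_ringRemainder`
# (crux stmt-KontsevichZagierPeriods-11102 `Grothendieck.SectorComplement`, line `containment-join`)

Elaboration sanity for the helper-lemma STATEMENTS proposed in
`STUB-IDEAS-stub_ringRemainder-1.md`. Nothing here is a line or a registered stub.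
`sorry` only inside the two proposed helpers HB1/HB2 (§B); §A and §C are closed terms over
tree theorems (recognition certificate and the conditional import).
-/

noncomputable section

set_option linter.dupNamespace false

namespace Summit.KontsevichZagierPeriods.KontsevichZagierPeriods.Cruxes.SectorComplement.StubIdeasRingRemainder1

open Set MeasureTheory
open Literature.NumberTheory.Transcendental
open Literature.NumberTheory.Transcendental.KZ
open Summit.KontsevichZagierPeriods.KontsevichZagierPeriods.Theses.Grothendieck
open Summit.KontsevichZagierPeriods.Grothendieck.GpcLegendreLemniscaticNegative (kRep eRep)
open Summit.KontsevichZagierPeriods.Grothendieck.LemniscaticSectorGlue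
open Summit.KontsevichZagierPeriods.Grothendieck.SectorComplementAmalgamation
open Summit.KontsevichZagierPeriods.MzvKernelInKZ.Negative
open Summit.KontsevichZagierPeriods.Grothendieck.SectorComplementRingJoin
  (ringRemainder_iff_crux stub_ringJoin lsk_iff_ringJoinKernel)
open Summit.KontsevichZagierPeriods.KontsevichZagierPeriods.Cruxes.SectorComplement.Strategist
  (crux_iff_legendre_imp summit_iff_evalP_injective h1_iff_legendre legendre_of_summit)
open Summit.KontsevichZagierPeriods.KontsevichZagierPeriods (TypeAGenerationConjecture)
open Summit.KontsevichZagierPeriods.KontsevichZagierPeriods.Theses.LiftingCriteria (CubeNashNormalForm)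
open Summit.KontsevichZagierPeriods.KontsevichZagierPeriods.StokesGenerationLine
  (kontsevichZagierPeriods_of_typeAGenerationConjecture
    equivalent_of_value_eq_of_dimLEOne_of_typeAGenerationConjecture)

/-- The stub's hypothesis: `evalP` injective on the ring join `ℤ[κ, ε, ϖ, ⟦W₂ ∪ W₄⟧]`
(local abbreviation; verbatim the antecedent of the registered `stub_ringRemainder`). -/
def RingJoinKernel : Prop :=
  ∀ (p : IntegralRep 1), p.domain = Set.univ → (p.integrand = fun x => 1 / (1 + x 0 ^ 2)) →
    ∀ x ∈ Subring.closure
        ({toFormalPeriod (of kRep), toFormalPeriod (of eRep), toFormalPeriod (of p)} ∪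
          toFormalPeriod '' (genSetAdm 2 ∪ genSetAdm 4)),
      evalP x = 0 → x = 0

/-- The registered stub, verbatim modulo the abbreviation. -/
def Stub : Prop := RingJoinKernel → KontsevichZagierPeriods

/-- Read-back: `Stub` is literally the registered signature. -/
example : Stub = ((∀ (p : IntegralRep 1), p.domain = Set.univ →
    (p.integrand = fun x => 1 / (1 + x 0 ^ 2)) →
      ∀ x ∈ Subring.closure
          ({toFormalPeriod (of kRep), toFormalPeriod (of eRep), toFormalPeriod (of p)} ∪
            toFormalPeriod '' (genSetAdm 2 ∪ genSetAdm 4)),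
        evalP x = 0 → x = 0) → KontsevichZagierPeriods) := rfl

/-! ## §A Recognition certificate (FAMILY 1, tree match) — all closed over tree theorems -/

/-- A1. The stub IS the crux (landed read-back `ringRemainder_iff_crux`, p105421). -/
theorem stub_iff_crux : Stub ↔ SectorComplement := ringRemainder_iff_crux

/-- A2. The stub's hypothesis IS the rank-5 crux 0280 (Legendre chain), unconditionally
(`lsk_iff_ringJoinKernel` + `h1_iff_legendre`, the latter via the proved 8611/8612). -/
theorem hyp_iff_legendre : RingJoinKernel ↔ GpcLegendreLemniscatic :=
  lsk_iff_ringJoinKernel.symm.trans h1_iff_legendre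

/-- A3. Hence the stub is `0280 → Conjecture 1` — Kontsevich–Zagier 2001 §1.2 Conj. 1 for ALL pairs,
given one Legendre chain. -/
theorem stub_iff_legendre_imp : Stub ↔ (GpcLegendreLemniscatic → KontsevichZagierPeriods) :=
  stub_iff_crux.trans crux_iff_legendre_imp

/-- A4. The hypothesis is INERT: it is a consequence of the conclusion. -/
theorem hyp_of_conclusion (h : KontsevichZagierPeriods) : RingJoinKernel :=
  hyp_iff_legendre.mpr (legendre_of_summit h)

/-- A5. So, the day 0280 closes, the stub is literally the summit. -/
theorem stub_iff_summit_of_legendre (h0280 : GpcLegendreLemniscatic) : Stub ↔ KontsevichZagierPeriods :=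
  ⟨fun h => h (hyp_iff_legendre.mpr h0280), fun h _ => h⟩

/-! ## §B The subfield's standard tool, typed: RELATIVE Krull squeeze over the ring join
(the only form in which the stub's hypothesis is load-bearing). Proposed helpers HB1, HB2. -/

/-- **HB1 (pure commutative algebra, one cycle).** If `evalP` is injective on a subring `R`, `P` is a
domain, and every value-zero class is a root of a non-zero polynomial with coefficients in `R`, then
`evalP` is injective. Proof shape = `Strategist.summit_iff_integrality_and_algebraicKernel` (⇐) with
`ℤ` replaced by `R`: strip `X^k` off `f`, cancel `c^k` in the domain, evaluate the cofactor at
`evalP c = 0` to put its constant coefficient in `R ∩ ker evalP = 0`. -/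
theorem HB1_injective_of_isDomain_of_algebraicOver (R : Subring FormalPeriodRing)
    (hR : ∀ x ∈ R, evalP x = 0 → x = 0) (hD : IsDomain FormalPeriodRing)
    (hA : ∀ c : FormalPeriodRing, evalP c = 0 →
      ∃ f : Polynomial FormalPeriodRing, f ≠ 0 ∧ (∀ i, f.coeff i ∈ R) ∧ f.IsRoot c) :
    Function.Injective evalP := by
  sorry

/-- **HB2 (one cycle from HB1 + `summit_iff_evalP_injective`).** The stub, reshaped so that its
hypothesis is USED: given the ring-join kernel, Conjecture 1 ⇔ (`P` is a domain) ∧ (every value-zero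
class is algebraic over the ring join inside `P`). (⇒) is trivial (kernel `= 0`, root of `X`);
(⇐) is HB1 with `R :=` the ring join. Both conjuncts remain open-problem-hard (see the plan). -/
theorem HB2_stub_iff_relativeSqueeze :
    Stub ↔ (RingJoinKernel → IsDomain FormalPeriodRing ∧
      ∀ (p : IntegralRep 1), p.domain = Set.univ → (p.integrand = fun x => 1 / (1 + x 0 ^ 2)) →
        ∀ c : FormalPeriodRing, evalP c = 0 →
          ∃ f : Polynomial FormalPeriodRing, f ≠ 0 ∧
            (∀ i, f.coeff i ∈ Subring.closure
              ({toFormalPeriod (of kRep), toFormalPeriod (of eRep), toFormalPeriod (of p)} ∪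
                toFormalPeriod '' (genSetAdm 2 ∪ genSetAdm 4))) ∧ f.IsRoot c) := by
  sorry

/-! ## §C Conditional import (FAMILY 1, tree match): the only non-circular assembly in the tree -/

/-- C1. The landed bridge `TypeAGenerationConjecture → CubeNashNormalForm → KontsevichZagierPeriods`
(Theorems/UnfoldedStokesStokesGenerationLineReductionNamed.lean, 2026-08-16) closes the stub WITHOUT its
hypothesis — modulo Ayoub 2015 Conj. 1.1 (`@[conjecture]`, open) and LiftingCriteria's 3574 (open, L). -/
theorem stub_of_typeA_of_cubeNash (hT : TypeAGenerationConjecture) (hN : CubeNashNormalForm) : Stub :=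
  fun _ => kontsevichZagierPeriods_of_typeAGenerationConjecture hT hN

/-- C2. What `TypeAGenerationConjecture` ALONE imports (no normal form): Conjecture 1 in dimension ≤ 1. -/
example (hT : TypeAGenerationConjecture) (r r' : IntegralRep 1) (hv : r.value = r'.value) :
    Equivalent r r' :=
  equivalent_of_value_eq_of_dimLEOne_of_typeAGenerationConjecture hT le_rfl le_rfl r r' hv

end Summit.KontsevichZagierPeriods.KontsevichZagierPeriods.Cruxes.SectorComplement.StubIdeasRingRemainder1

end
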